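import Summits.AtomisticToContinuum.Crystallization.Theorems.ExcessDecayLiouvilleAffineFieldsBasic

/-!
# Route `ExcessDecayLiouville`: the bond-class weight sum (long-range differences, part II)

Analytic half of the localised long-range estimate for item `ExcessDecay` (stmt-AtomisticToContinuum-9334),
harmonic-replacement architecture.  A bond class is `(m, m′, ζ) ∈ Fin 2 × Fin 2 × ℤ³` (from sublattice `m` to
sublattice `m′`, lattice offset `ζ`); its length is `d = dist (t m) (t m′ + A z(ζ))` and it is bridged by a
nearest-neighbour path of `n ≤ |i| + |j| + 2|k| + 2` steps.  The long-range estimate costs `Σ_classes d⁻⁸ n²`,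
which we bound uniformly over coordinate boxes:

* `classLen_ge`, `classLen_ge_norm` : `d ≥ 23/25` for a nontrivial class and `d ≥ (189/200)‖z‖ − 11/10`;
* `pathLen_le_norm` : `n ≤ 6‖z‖ + 2`;
* `classWeight_le` : `d⁻⁸ n² ≤ 1320·𝟙[‖z‖ ≤ 4] + 1100·‖z‖⁻⁶·𝟙[4 < ‖z‖]`;
* `sum_box_indicator_le` (`≤ 729`, packing) and `sum_box_inv_pow_six_le` (`≤ 16`, dyadic shells);
* `classWeight_sum_le` : `Σ_{m,m′} Σ_{ζ ∈ box} [class nontrivial] d⁻⁸ n² ≤ 4·10⁶`.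

All `[folklore]`; helper lemmas, nothing here closes an item.
-/

noncomputable section

namespace Summit.AtomisticToContinuum.Crystallization.Theorems.ExcessDecayLiouville

open scoped BigOperators Topology InnerProductSpace RealInnerProductSpace Classical
open Literature.MathematicalPhysics.StatisticalMechanics
open Summit.AtomisticToContinuum.Crystallization.Theorems.PhononStabilityNegative
open Summit.AtomisticToContinuum.Crystallization.Theorems

-- lattice vector with integer coordinates
local notation "𝐳[" i ", " j ", " k "]" =>
  (((i : ℤ) : ℝ) • (triangularVec₁ 1 : EuclideanSpace ℝ (Fin 3)) + ((j : ℤ) : ℝ) • triangularVec₂ 1 +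
    ((k : ℤ) : ℝ) • layerNormal (2 * Real.sqrt (2 / 3)))

section

variable {t : Fin 2 → (EuclideanSpace ℝ (Fin 3))} {A : (EuclideanSpace ℝ (Fin 3)) →L[ℝ] (EuclideanSpace ℝ (Fin 3))}

/-- `z(0,0,0) = 0`. [folklore] -/
theorem latticeVec_zero : 𝐳[(0 : ℤ), (0 : ℤ), (0 : ℤ)] = 0 := by simp

/-- A nontrivial bond class has length `≥ 23/25` (distinct sites). [folklore] -/
theorem classLen_ge (hA : Adm₀ A) (hI : Inner₀ t A) {m m' : Fin 2} {ζ : ℤ × ℤ × ℤ} (h : ¬ (m = m' ∧ ζ = 0)) :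
    23 / 25 ≤ dist (t m) (t m' + A 𝐳[ζ.1, ζ.2.1, ζ.2.2]) := by
  have hp : t m ∈ Sites₀ t A := ⟨m, 0, by simpa using latticeVec_mem_Λ₀ 0 0 0, by simp⟩
  have hq : t m' + A 𝐳[ζ.1, ζ.2.1, ζ.2.2] ∈ Sites₀ t A := ⟨m', _, latticeVec_mem_Λ₀ _ _ _, rfl⟩
  refine dist_sites_ge hA hI hp hq fun heq => h ?_
  have heq' : t m + A 0 = t m' + A 𝐳[ζ.1, ζ.2.1, ζ.2.2] := by simpa using heq
  obtain ⟨hmm, hz⟩ := site_repr_unique hA hI (by simpa using latticeVec_mem_Λ₀ 0 0 0) (latticeVec_mem_Λ₀ _ _ _) heq'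
  refine ⟨hmm, ?_⟩
  have hz' : 𝐳[(0 : ℤ), (0 : ℤ), (0 : ℤ)] = 𝐳[ζ.1, ζ.2.1, ζ.2.2] := by rw [latticeVec_zero]; exact hz
  obtain ⟨h1, h2, h3⟩ := latticeCoords_eq hz'
  ext <;> simp [← h1, ← h2, ← h3]

/-- The length of a bond class is at least `(189/200)‖z‖ − 11/10`. [folklore] -/
theorem classLen_ge_norm (hA : Adm₀ A) (hI : Inner₀ t A) (m m' : Fin 2) (ζ : ℤ × ℤ × ℤ) :
    189 / 200 * ‖𝐳[ζ.1, ζ.2.1, ζ.2.2]‖ - 11 / 10 ≤ dist (t m) (t m' + A 𝐳[ζ.1, ζ.2.1, ζ.2.2]) := by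
  have h1 := hcpLiouvilleAdm_norm_le hA 𝐳[ζ.1, ζ.2.1, ζ.2.2]
  have h2 : ‖t m - t m'‖ ≤ 11 / 10 := by
    fin_cases m <;> fin_cases m'
    · norm_num
    · simpa [norm_sub_rev] using norm_t_sub_t_le hA hI
    · simpa using norm_t_sub_t_le hA hI
    · norm_num
  rw [dist_eq_norm]
  have : t m - (t m' + A 𝐳[ζ.1, ζ.2.1, ζ.2.2]) = (t m - t m') - A 𝐳[ζ.1, ζ.2.1, ζ.2.2] := by abel
  rw [this]
  have h3 := norm_sub_norm_le (A 𝐳[ζ.1, ζ.2.1, ζ.2.2]) (t m - t m')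
  rw [norm_sub_rev (A 𝐳[ζ.1, ζ.2.1, ζ.2.2]) (t m - t m')] at h3
  linarith

/-- The path length of a bond class is `≤ 6‖z‖ + 2`. [folklore] -/
theorem pathLen_le_norm (ζ : ℤ × ℤ × ℤ) :
    ((ζ.1.natAbs + ζ.2.1.natAbs + 2 * ζ.2.2.natAbs + 2 : ℕ) : ℝ) ≤ 6 * ‖𝐳[ζ.1, ζ.2.1, ζ.2.2]‖ + 2 := by
  obtain ⟨hi, hj, hk⟩ := abs_coord_le_norm_latticeVec ζ.1 ζ.2.1 ζ.2.2
  have e1 : ((ζ.1.natAbs : ℕ) : ℝ) = |(ζ.1 : ℝ)| := by rw [Nat.cast_natAbs, Int.cast_abs]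
  have e2 : ((ζ.2.1.natAbs : ℕ) : ℝ) = |(ζ.2.1 : ℝ)| := by rw [Nat.cast_natAbs, Int.cast_abs]
  have e3 : ((ζ.2.2.natAbs : ℕ) : ℝ) = |(ζ.2.2 : ℝ)| := by rw [Nat.cast_natAbs, Int.cast_abs]
  push_cast
  rw [e1, e2, e3]
  linarith

/-- **Termwise weight bound**: `d⁻⁸ n² ≤ 1320·𝟙[‖z‖ ≤ 4] + 1100·‖z‖⁻⁶·𝟙[4 < ‖z‖]` for a nontrivial class.
[folklore] -/
theorem classWeight_le (hA : Adm₀ A) (hI : Inner₀ t A) {m m' : Fin 2} {ζ : ℤ × ℤ × ℤ} (h : ¬ (m = m' ∧ ζ = 0)) :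
    (dist (t m) (t m' + A 𝐳[ζ.1, ζ.2.1, ζ.2.2]))⁻¹ ^ 8 * ((ζ.1.natAbs + ζ.2.1.natAbs + 2 * ζ.2.2.natAbs + 2 : ℕ) : ℝ) ^ 2 ≤
      1320 * (if ‖𝐳[ζ.1, ζ.2.1, ζ.2.2]‖ ≤ 4 then (1 : ℝ) else 0) +
        1100 * (if 4 < ‖𝐳[ζ.1, ζ.2.1, ζ.2.2]‖ then (‖𝐳[ζ.1, ζ.2.1, ζ.2.2]‖⁻¹) ^ 6 else 0) := by
  set d := dist (t m) (t m' + A 𝐳[ζ.1, ζ.2.1, ζ.2.2]) with hd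
  set Z := ‖𝐳[ζ.1, ζ.2.1, ζ.2.2]‖ with hZ
  set n : ℝ := ((ζ.1.natAbs + ζ.2.1.natAbs + 2 * ζ.2.2.natAbs + 2 : ℕ) : ℝ) with hn
  have hd0 : 23 / 25 ≤ d := classLen_ge hA hI h
  have hdZ : 189 / 200 * Z - 11 / 10 ≤ d := classLen_ge_norm hA hI m m' ζ
  have hnZ : n ≤ 6 * Z + 2 := pathLen_le_norm ζ
  have hn0 : 0 ≤ n := by rw [hn]; positivity
  have hdpos : 0 < d := by linarith
  have hZ0 : 0 ≤ Z := norm_nonneg _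
  by_cases hZ4 : Z ≤ 4
  · rw [if_pos hZ4, if_neg (not_lt.2 hZ4), mul_zero, add_zero, mul_one]
    have hn26 : n ≤ 26 := by linarith
    have hdinv : d⁻¹ ≤ 25 / 23 := by rw [inv_le_comm₀ hdpos (by norm_num)]; linarith
    have hdinv0 : 0 ≤ d⁻¹ := by positivity
    have h8 : d⁻¹ ^ 8 ≤ (25 / 23) ^ 8 := pow_le_pow_left₀ hdinv0 hdinv 8
    have hn2 : n ^ 2 ≤ 26 ^ 2 := pow_le_pow_left₀ hn0 hn26 2
    calc d⁻¹ ^ 8 * n ^ 2 ≤ (25 / 23) ^ 8 * 26 ^ 2 := mul_le_mul h8 hn2 (sq_nonneg _) (by positivity)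
      _ ≤ 1320 := by norm_num
  · have hZ4' : 4 < Z := lt_of_not_ge hZ4
    rw [if_neg hZ4, if_pos hZ4', mul_zero, zero_add]
    have hZpos : 0 < Z := by linarith
    have hd67 : 67 / 100 * Z ≤ d := by linarith
    have hn65 : n ≤ 13 / 2 * Z := by linarith
    have hdinv : d⁻¹ ≤ (67 / 100 * Z)⁻¹ := inv_anti₀ (by positivity) hd67
    have hdinv0 : 0 ≤ d⁻¹ := by positivity
    have h8 : d⁻¹ ^ 8 ≤ ((67 / 100 * Z)⁻¹) ^ 8 := pow_le_pow_left₀ hdinv0 hdinv 8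
    have hn2 : n ^ 2 ≤ (13 / 2 * Z) ^ 2 := pow_le_pow_left₀ hn0 hn65 2
    have hZi : (67 / 100 * Z)⁻¹ = 100 / 67 * Z⁻¹ := by rw [mul_inv]; norm_num
    calc d⁻¹ ^ 8 * n ^ 2 ≤ ((67 / 100 * Z)⁻¹) ^ 8 * (13 / 2 * Z) ^ 2 := mul_le_mul h8 hn2 (sq_nonneg _) (by positivity)
      _ = ((100 / 67) ^ 8 * (13 / 2) ^ 2) * ((Z⁻¹) ^ 8 * Z ^ 2) := by rw [hZi]; ring
      _ = ((100 / 67) ^ 8 * (13 / 2) ^ 2) * (Z⁻¹) ^ 6 := by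
          congr 1
          field_simp
      _ ≤ 1100 * (Z⁻¹) ^ 6 := by gcongr; norm_num

/-- The lattice points of a coordinate box within distance `4` of the origin are at most `729`. [folklore] -/
theorem sum_box_indicator_le (N : ℕ) :
    ∑ ζ ∈ (Finset.Icc (-(N : ℤ)) N) ×ˢ (Finset.Icc (-(N : ℤ)) N) ×ˢ (Finset.Icc (-(N : ℤ)) N),
      (if ‖𝐳[ζ.1, ζ.2.1, ζ.2.2]‖ ≤ 4 then (1 : ℝ) else 0) ≤ 729 := by
  classical
  set box := (Finset.Icc (-(N : ℤ)) N) ×ˢ (Finset.Icc (-(N : ℤ)) N) ×ˢ (Finset.Icc (-(N : ℤ)) N) with hbox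
  set F := (box.filter fun ζ : ℤ × ℤ × ℤ => ‖𝐳[ζ.1, ζ.2.1, ζ.2.2]‖ ≤ 4).image
    (fun ζ : ℤ × ℤ × ℤ => 𝐳[ζ.1, ζ.2.1, ζ.2.2]) with hF
  rw [← Finset.sum_filter]
  simp only [Finset.sum_const, nsmul_eq_mul, mul_one]
  have hcard : ((box.filter fun ζ : ℤ × ℤ × ℤ => ‖𝐳[ζ.1, ζ.2.1, ζ.2.2]‖ ≤ 4).card : ℝ) = F.card := by
    rw [hF, Finset.card_image_of_injective _ latticeBox_injective]
  rw [hcard]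
  have h := card_le_of_separated_of_dist_le F 0 (by norm_num : (0 : ℝ) < 1) (by norm_num : (0 : ℝ) ≤ 4) ?_ ?_
  · rw [finrank_euclideanSpace_fin] at h
    refine h.trans ?_
    norm_num
  · intro a ha
    simp only [hF, Finset.mem_image, Finset.mem_filter] at ha
    obtain ⟨ζ, ⟨-, hζ⟩, rfl⟩ := ha
    simpa using hζ
  · intro a ha b hb hab
    simp only [hF, Finset.mem_image, Finset.mem_filter] at ha hb
    obtain ⟨ζ, -, rfl⟩ := ha
    obtain ⟨ζ', -, rfl⟩ := hb
    rw [dist_eq_norm]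
    exact hcpLiouvilleLam_one_le_norm (hcpLiouvilleLam_sub_mem (latticeVec_mem_Λ₀ _ _ _) (latticeVec_mem_Λ₀ _ _ _))
      (sub_ne_zero.2 hab)

/-- The far lattice points of a coordinate box have `Σ ‖z‖⁻⁶ ≤ 16`. [folklore] -/
theorem sum_box_inv_pow_six_le (N : ℕ) :
    ∑ ζ ∈ (Finset.Icc (-(N : ℤ)) N) ×ˢ (Finset.Icc (-(N : ℤ)) N) ×ˢ (Finset.Icc (-(N : ℤ)) N),
      (if 4 < ‖𝐳[ζ.1, ζ.2.1, ζ.2.2]‖ then (‖𝐳[ζ.1, ζ.2.1, ζ.2.2]‖⁻¹) ^ 6 else 0) ≤ 16 := by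
  classical
  set box := (Finset.Icc (-(N : ℤ)) N) ×ˢ (Finset.Icc (-(N : ℤ)) N) ×ˢ (Finset.Icc (-(N : ℤ)) N) with hbox
  set F := (box.filter fun ζ : ℤ × ℤ × ℤ => 4 < ‖𝐳[ζ.1, ζ.2.1, ζ.2.2]‖).image
    (fun ζ : ℤ × ℤ × ℤ => 𝐳[ζ.1, ζ.2.1, ζ.2.2]) with hF
  rw [← Finset.sum_filter]
  have hsum : ∑ ζ ∈ box.filter (fun ζ : ℤ × ℤ × ℤ => 4 < ‖𝐳[ζ.1, ζ.2.1, ζ.2.2]‖), (‖𝐳[ζ.1, ζ.2.1, ζ.2.2]‖⁻¹) ^ 6 =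
      ∑ a ∈ F, (dist a 0)⁻¹ ^ (3 + 3) := by
    rw [hF, Finset.sum_image (fun x _ y _ h => latticeBox_injective h)]
    refine Finset.sum_congr rfl fun ζ _ => ?_
    rw [dist_zero_right]
  rw [hsum]
  have h := sum_inv_pow_le_of_separated F 0 (by norm_num : 1 ≤ 3) (by norm_num : (0 : ℝ) < 1) (by norm_num : (1 : ℝ) ≤ 4) ?_ ?_
  · refine h.trans ?_; norm_num
  · intro a ha b hb hab
    simp only [hF, Finset.mem_image, Finset.mem_filter] at ha hb
    obtain ⟨ζ, -, rfl⟩ := ha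
    obtain ⟨ζ', -, rfl⟩ := hb
    rw [dist_eq_norm]
    exact hcpLiouvilleLam_one_le_norm (hcpLiouvilleLam_sub_mem (latticeVec_mem_Λ₀ _ _ _) (latticeVec_mem_Λ₀ _ _ _))
      (sub_ne_zero.2 hab)
  · intro a ha
    simp only [hF, Finset.mem_image, Finset.mem_filter] at ha
    obtain ⟨ζ, ⟨-, hζ⟩, rfl⟩ := ha
    rw [dist_zero_right]
    exact hζ.le

/-- **The bond-class weight sum is bounded**: `Σ_{m,m′} Σ_{ζ ∈ box} [nontrivial] d⁻⁸ n² ≤ 4·10⁶`, uniformly in the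
box. [folklore] -/
theorem classWeight_sum_le (hA : Adm₀ A) (hI : Inner₀ t A) (N : ℕ) :
    ∑ m : Fin 2, ∑ m' : Fin 2, ∑ ζ ∈ (Finset.Icc (-(N : ℤ)) N) ×ˢ (Finset.Icc (-(N : ℤ)) N) ×ˢ (Finset.Icc (-(N : ℤ)) N),
      (if (m = m' ∧ ζ = 0) then (0 : ℝ) else
        (dist (t m) (t m' + A 𝐳[ζ.1, ζ.2.1, ζ.2.2]))⁻¹ ^ 8 * ((ζ.1.natAbs + ζ.2.1.natAbs + 2 * ζ.2.2.natAbs + 2 : ℕ) : ℝ) ^ 2) ≤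
      4000000 := by
  classical
  set box := (Finset.Icc (-(N : ℤ)) N) ×ˢ (Finset.Icc (-(N : ℤ)) N) ×ˢ (Finset.Icc (-(N : ℤ)) N) with hbox
  have hinner : ∀ m m' : Fin 2, ∑ ζ ∈ box,
      (if (m = m' ∧ ζ = 0) then (0 : ℝ) else
        (dist (t m) (t m' + A 𝐳[ζ.1, ζ.2.1, ζ.2.2]))⁻¹ ^ 8 * ((ζ.1.natAbs + ζ.2.1.natAbs + 2 * ζ.2.2.natAbs + 2 : ℕ) : ℝ) ^ 2) ≤
      1000000 := by
    intro m m'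
    have h1 := sum_box_indicator_le N
    have h2 := sum_box_inv_pow_six_le N
    rw [← hbox] at h1 h2
    have hterm : ∀ ζ ∈ box, (if (m = m' ∧ ζ = 0) then (0 : ℝ) else
        (dist (t m) (t m' + A 𝐳[ζ.1, ζ.2.1, ζ.2.2]))⁻¹ ^ 8 * ((ζ.1.natAbs + ζ.2.1.natAbs + 2 * ζ.2.2.natAbs + 2 : ℕ) : ℝ) ^ 2) ≤
        1320 * (if ‖𝐳[ζ.1, ζ.2.1, ζ.2.2]‖ ≤ 4 then (1 : ℝ) else 0) +
          1100 * (if 4 < ‖𝐳[ζ.1, ζ.2.1, ζ.2.2]‖ then (‖𝐳[ζ.1, ζ.2.1, ζ.2.2]‖⁻¹) ^ 6 else 0) := by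
      intro ζ _
      by_cases h : m = m' ∧ ζ = 0
      · rw [if_pos h]
        have : (0 : ℝ) ≤ (if ‖𝐳[ζ.1, ζ.2.1, ζ.2.2]‖ ≤ 4 then (1 : ℝ) else 0) := by split_ifs <;> norm_num
        have : (0 : ℝ) ≤ (if 4 < ‖𝐳[ζ.1, ζ.2.1, ζ.2.2]‖ then (‖𝐳[ζ.1, ζ.2.1, ζ.2.2]‖⁻¹) ^ 6 else 0) := by
          split_ifs <;> positivity
        positivity
      · rw [if_neg h]
        exact classWeight_le hA hI h
    refine (Finset.sum_le_sum hterm).trans ?_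
    rw [Finset.sum_add_distrib, ← Finset.mul_sum, ← Finset.mul_sum]
    linarith
  calc ∑ m : Fin 2, ∑ m' : Fin 2, ∑ ζ ∈ box,
        (if (m = m' ∧ ζ = 0) then (0 : ℝ) else
          (dist (t m) (t m' + A 𝐳[ζ.1, ζ.2.1, ζ.2.2]))⁻¹ ^ 8 * ((ζ.1.natAbs + ζ.2.1.natAbs + 2 * ζ.2.2.natAbs + 2 : ℕ) : ℝ) ^ 2)
      ≤ ∑ m : Fin 2, ∑ m' : Fin 2, (1000000 : ℝ) :=
        Finset.sum_le_sum fun m _ => Finset.sum_le_sum fun m' _ => hinner m m'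
    _ = 4000000 := by simp; norm_num

end

end Summit.AtomisticToContinuum.Crystallization.Theorems.ExcessDecayLiouville

end
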